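import Summits.CriticalPhenomena.PercolationContinuityZ3.Theorems.SahiGridPatternOrderNThree

/-!
# The order-4 kernel in closed form (the object behind the cells `(2,4)` and `(3,4)`)

Support file (Sahi cell `prim-sahi`, seat `prim-sahi-typer`, generation 26; `--supports stmt-CriticalPhenomena-4575`).  Pure proof, no
definitions, no `sorry`, standard axioms.

Unfolding the recursion once more (`copyKernel_three` is in `…OrderNThree`): **`copyKernel_four`** — the fifteen set-partition terms of
Sahi's `E₄ = 6E_(4) − 2E_(3,1) − E_(2,2) + E_(2,1,1) − E_(1,1,1,1)` [Sahi2008, p. 213; LiebSahi2021, display after Def. 3.1], each block of a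
partition of the slots `{0,1,2,3}` evaluated at the copy equal to its LARGEST slot (the recursion's canonical copy assignment; rows = slots,
columns = copies).  This is the integrand of the pattern functional `sStarN 4 d` and of the pattern tensor `patTensor 4 d`. [this work]
-/

namespace Summit.CriticalPhenomena.PercolationContinuityZ3.Theorems.SahiGridPatternN

open Finset
open SahiCopyKernel (copyKernel mtail copyKernel_succ_succ)
open scoped BigOperators

/-- **`K_4` in closed form** (15 terms; block `B` of each set partition at copy `max B`):
`6·[0123@3] − 2([123@3][0@0] + [023@3][1@1] + [013@3][2@2] + [012@2][3@3]) − ([01@1][23@3] + [02@2][13@3] + [03@3][12@2])`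
`+ ([01@1][2@2][3@3] + [02@2][1@1][3@3] + [03@3][1@1][2@2] + [12@2][0@0][3@3] + [13@3][0@0][2@2] + [23@3][0@0][1@1]) − [0@0][1@1][2@2][3@3]`.
[this work] -/
theorem copyKernel_four {R : Type*} [CommRing R] (M : Fin 4 → Fin 4 → R) :
    copyKernel 4 M =
      6 * (M 0 3 * M 1 3 * M 2 3 * M 3 3)
      - 2 * (M 1 3 * M 2 3 * M 3 3 * M 0 0 + M 0 3 * M 2 3 * M 3 3 * M 1 1 + M 0 3 * M 1 3 * M 3 3 * M 2 2
              + M 0 2 * M 1 2 * M 2 2 * M 3 3)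
      - (M 0 1 * M 1 1 * (M 2 3 * M 3 3) + M 0 2 * M 2 2 * (M 1 3 * M 3 3) + M 0 3 * M 3 3 * (M 1 2 * M 2 2))
      + (M 0 1 * M 1 1 * M 2 2 * M 3 3 + M 0 2 * M 2 2 * M 1 1 * M 3 3 + M 0 3 * M 3 3 * M 1 1 * M 2 2
          + M 1 2 * M 2 2 * M 0 0 * M 3 3 + M 1 3 * M 3 3 * M 0 0 * M 2 2 + M 2 3 * M 3 3 * M 0 0 * M 1 1)
      - M 0 0 * M 1 1 * M 2 2 * M 3 3 := by
  rw [copyKernel_succ_succ, Fin.sum_univ_three, copyKernel_three, copyKernel_three, copyKernel_three, copyKernel_three]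
  simp only [mtail, Function.update_self, Function.update_of_ne (show (1 : Fin 3) ≠ 0 by decide),
    Function.update_of_ne (show (2 : Fin 3) ≠ 0 by decide), Function.update_of_ne (show (0 : Fin 3) ≠ 1 by decide),
    Function.update_of_ne (show (2 : Fin 3) ≠ 1 by decide), Function.update_of_ne (show (0 : Fin 3) ≠ 2 by decide),
    Function.update_of_ne (show (1 : Fin 3) ≠ 2 by decide), Fin.succ_zero_eq_one, Fin.succ_one_eq_two]
  show _ = _
  have h3 : (Fin.succ (2 : Fin 3) : Fin 4) = 3 := rfl
  simp only [h3]
  ring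

end Summit.CriticalPhenomena.PercolationContinuityZ3.Theorems.SahiGridPatternN
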